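import Literature.IUT.HodgeTheaters.GoodLocalFrobenioidOfGaloisUnitRigidity
import HarnessLib

/-!
# [IUTchI] Example 3.3 (iii) (e) over the REAL bases: the unit transport of `Ψ` is valuation-preserving on `K̄_v`,
# extends to `K̄_v`, and — given the anabelian input — is `Gal(K̄_v/K_v)`-equivariant after untwisting

Mochizuki, *Inter-universal Teichmüller theory I*, kurims manuscript (May 2020), Example 3.3 (iii) (e), p. 79
[claim: Mochizuki2012, status: disputed] ("one may reconstruct the split Frobenioids `F⊢_v`, `F^Θ_v` category-theoretically
from `F̲_v`", the preceding sentence citing [AbsTopIII], Proposition 3.2, (iii); Rmk. 3.3.2: `C_v` "consists of essentially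
the same data as an MLF-Galois TM-pair of strictly Belyi type") — nothing of the series is asserted; no side is taken on
[IUTchIII] Cor. 3.12.  Mochizuki, *The geometry of Frobenioids II*, Kyushu J. Math. **62** (2008), proof of Thm. 2.4 (ii),
p. 18 ("`Ψ` induces a pair of compatible isomorphisms `G₁ ⥲ G₂`; `K̄₁^× ⥲ K̄₂^×`") [cite: MochizukiFrdII2008, Thm 2.4 (ii) p.18].

PROOF-ONLY file (abc-iut cell, seat abc-iut-L5-t16 gen 7; row E33iii/e «hfix at the genuine datum», piece (F3c)), no
definitions, no new `Prop`.  For a map `C : O^▷_Ω → O^▷_Ω` as produced by `UnitTransport.exists_unitTransport`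
(multiplicative, units to units and only units, `v(C p) = v(p)`):
* `valuation_map_eq_of_units` — **`C` preserves the valuation of `Ω`** as soon as every nonzero integer `x` of `Ω` has
  `v(x)^b = v(p)^a` for some `b ≥ 1` (true over a `p`-adic field: `exists_valuation_pow_eq`, from the `ℤ`-monoprimality
  of `ord(O^▷)` of the fields of the tower, abc-iut-L1's `Datum.isZMonoprime_ordInt_fld`);
* `exists_extend_monoidWithZeroHom` — **extension to `Ω →*₀ Ω`** when `v(p^N x) ≤ 1` for `N ≫ 0` (`x ↦ C(p^N x)/C(p)^N`),
  keeping multiplicativity, the valuation, and any semilinearity `C(aug(g)·x) = aug(φ g)·C(x)`;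
* `map_natCast_eq_of_geometric` — **the anabelian input (E2) untwists the semilinearity**: if `φ` is covered by a
  valuation-preserving ring automorphism `σ` of `Ω` (`σ(aug(g)·x) = aug(φ g)·σ(x)` — our reading of print's two anabelian inputs on
  p. 79: the Kummer map of "[AbsTopIII], Proposition 3.2, (iii)" (l. 52–53) and "the curve `X_F` is “of strictly Belyi type”"
  [cf. [AbsTopIII], Remark 2.8.3] (l. 58); a HYPOTHESIS here), then `σ⁻¹ ∘ C` is `Gal(Ω/k)`-equivariant and valuation-preserving, so
  by the Kummer rigidity (E3) of abc-iut-w4-d014 (`Literature.NumberTheory.LocalFields.map_algebraMap_eq_self_of_*`,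
  supplied as the hypothesis `hE3` in the generic form "every such endomorphism fixes `p`") `C(p) = σ(p) = p`.
The instantiation at `GoodLocalFrobenioid.ofGalois (GaloisValDatum.ofComplete p k)` is the sequel.
-/

noncomputable section

namespace Literature.IUT.HodgeTheaters

namespace GoodLocalFrobenioid

namespace UnitTransport

open CategoryTheory Opposite Function ValuativeRel Topology Filter Literature.AnabelianGeometry.SemiGraphs
open Literature.AlgebraicGeometry.Frobenioids Literature.AlgebraicGeometry.Frobenioids.PadicFrd
open Literature.AlgebraicGeometry.Frobenioids.BaseGaloisSystem

universe u

section Valuation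

variable {p : ℕ} [Fact p.Prime] (d : GaloisValDatum.{u} p)

/-- **Over a `p`-adic tower every nonzero integer of `Ω` has `v(x)^b = v(p)^a` with `b ≥ 1`.**  For a datum `Q` over
`CosetCat Π_v` read in `Ω` by `ε` and an element `x` coming from the field of an object `A` (`x = ε(y)`): `ord(O^▷_{K_A})`
is `ℤ`-monoprime (abc-iut-L1's `Datum.isZMonoprime_ordInt_fld`), so `[y]^b = [p]^a` with `b = ord(p) ≥ 1`, i.e.
`y^b = p^a · (unit)`. [cite: MochizukiFrdII2008, Ex 1.1 (i) p.7] -/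
theorem exists_valuation_pow_eq {P : Type u} [Group P] [TopologicalSpace P] (Q : Datum (CosetCat P) p)
    (ε : ∀ A : CosetCat P, Q.fld A →+* d.Ω) (hεle : ∀ (A : CosetCat P) (a b : Q.fld A), ε A a ≤ᵥ ε A b ↔ a ≤ᵥ b)
    (A : CosetCat P) (y : intNonzero (Q.fld A)) :
    ∃ b a : ℕ, 0 < b ∧ valuation d.Ω (ε A (y : Q.fld A)) ^ b = valuation d.Ω ((p : ℕ) : d.Ω) ^ a := by
  obtain ⟨⟨e⟩⟩ := Q.isZMonoprime_ordInt_fld A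
  have hεv : ∀ z : Q.fld A, valuation d.Ω (ε A z) = 1 ↔ valuation (Q.fld A) z = 1 := fun z => by
    rw [le_antisymm_iff, le_antisymm_iff, ← (valuation d.Ω).map_one, ← (valuation (Q.fld A)).map_one,
      ← Valuation.Compatible.vle_iff_le, ← Valuation.Compatible.vle_iff_le, ← Valuation.Compatible.vle_iff_le,
      ← Valuation.Compatible.vle_iff_le, ← (ε A).map_one, hεle, hεle]
  let pA : intNonzero (Q.fld A) := ⟨((p : ℕ) : Q.fld A), (Q.base.obj A).p_mem⟩
  set α := Multiplicative.toAdd (e (Associates.mk y)) with hα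
  set β := Multiplicative.toAdd (e (Associates.mk pA)) with hβ
  -- `β ≠ 0`: `p` is not a unit
  have hβ0 : β ≠ 0 := by
    intro h0
    have h1 : Associates.mk pA = 1 := e.injective (by
      rw [map_one]; exact Multiplicative.toAdd.injective (by rw [← hβ, h0, toAdd_one]))
    rw [Associates.mk_eq_one] at h1
    exact (Q.base.obj A).p_lt.ne ((isUnit_intNonzero_iff (Q.fld A) pA).mp h1)
  -- `[y]^β = [p]^α`
  have hcl : Associates.mk y ^ β = Associates.mk pA ^ α := e.injective (by
    rw [map_pow, map_pow]
    apply Multiplicative.toAdd.injective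
    rw [toAdd_pow, toAdd_pow, ← hα, ← hβ, smul_eq_mul, smul_eq_mul, mul_comm])
  rw [← Associates.mk_pow, ← Associates.mk_pow, Associates.mk_eq_mk_iff_associated] at hcl
  obtain ⟨u, hu⟩ := hcl
  have hu1 : valuation d.Ω (ε A ((u : intNonzero (Q.fld A)) : Q.fld A)) = 1 :=
    (hεv _).mpr ((isUnit_intNonzero_iff (Q.fld A) _).mp u.isUnit)
  refine ⟨β, α, Nat.pos_of_ne_zero hβ0, ?_⟩
  have hpA : ((pA : intNonzero (Q.fld A)) : Q.fld A) = (p : ℕ) := rfl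
  have h := congrArg (fun z : intNonzero (Q.fld A) => valuation d.Ω (ε A (z : Q.fld A))) hu
  simp only [Submonoid.coe_mul, SubmonoidClass.coe_pow, map_mul, map_pow, hu1, mul_one, hpA, map_natCast] at h
  exact h

/-- **A multiplicative self-map of `O^▷_Ω` carrying units to units and only units, with `v(C p) = v(p)`, preserves the
valuation** — provided every nonzero integer has `v(x)^b = v(p)^a` for some `b ≥ 1` (then `x^b = p^a·u` with `v(u) = 1`,
so `v(C x)^b = v(C p)^a · v(C u) = v(p)^a = v(x)^b`). [cite: MochizukiFrdII2008, Thm 2.4 (ii) p.18] -/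
theorem valuation_map_eq_of_units (C : ↥(intNonzero d.Ω) →* ↥(intNonzero d.Ω))
    (hunit : ∀ x : intNonzero d.Ω, valuation d.Ω ((C x : intNonzero d.Ω) : d.Ω) = 1 ↔ valuation d.Ω (x : d.Ω) = 1)
    (pΩ : intNonzero d.Ω) (hpΩ : (pΩ : d.Ω) = (p : ℕ))
    (hp : valuation d.Ω ((C pΩ : intNonzero d.Ω) : d.Ω) = valuation d.Ω ((p : ℕ) : d.Ω))
    (halg : ∀ x : intNonzero d.Ω, ∃ b a : ℕ, 0 < b ∧
      valuation d.Ω (x : d.Ω) ^ b = valuation d.Ω ((p : ℕ) : d.Ω) ^ a)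
    (x : intNonzero d.Ω) : valuation d.Ω ((C x : intNonzero d.Ω) : d.Ω) = valuation d.Ω (x : d.Ω) := by
  obtain ⟨b, a, hb, hval⟩ := halg x
  have hp0 : ((p : ℕ) : d.Ω) ≠ 0 := d.p_ne_zero_Ω
  have hpv0 : valuation d.Ω ((p : ℕ) : d.Ω) ≠ 0 := (Valuation.ne_zero_iff _).mpr hp0
  -- `u := x^b / p^a`, a nonzero integer of valuation `1`
  have hu1 : valuation d.Ω ((x : d.Ω) ^ b * (((p : ℕ) : d.Ω) ^ a)⁻¹) = 1 := by
    rw [Valuation.map_mul, Valuation.map_inv, Valuation.map_pow, Valuation.map_pow, hval,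
      mul_inv_cancel₀ (pow_ne_zero _ hpv0)]
  let u : intNonzero d.Ω := ⟨(x : d.Ω) ^ b * (((p : ℕ) : d.Ω) ^ a)⁻¹, hu1.le,
    mul_ne_zero (pow_ne_zero _ x.2.2) (inv_ne_zero (pow_ne_zero _ hp0))⟩
  have hfac : x ^ b = pΩ ^ a * u := Subtype.ext (by
    change (x : d.Ω) ^ b = (pΩ : d.Ω) ^ a * ((x : d.Ω) ^ b * (((p : ℕ) : d.Ω) ^ a)⁻¹)
    rw [hpΩ, mul_left_comm, mul_inv_cancel₀ (pow_ne_zero _ hp0), mul_one])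
  have h := congrArg (fun z : intNonzero d.Ω => valuation d.Ω ((C z : intNonzero d.Ω) : d.Ω)) hfac
  simp only [map_pow, map_mul, SubmonoidClass.coe_pow, Submonoid.coe_mul, hp, (hunit u).mpr hu1, mul_one] at h
  -- `v(C x)^b = v(p)^a = v(x)^b`
  rw [← hval] at h
  exact (pow_left_inj₀ zero_le zero_le hb.ne').mp h

end Valuation

/-! ### Extension to `Ω →*₀ Ω` -/

section Extension

variable {p : ℕ} [Fact p.Prime] (d : GaloisValDatum.{u} p)

/-- **Extension of a multiplicative, valuation-preserving self-map of `O^▷_Ω` to `Ω →*₀ Ω`**, assuming every element of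
`Ω` becomes an integer after multiplication by a power of `p` (`harch`; e.g. `Ω = k̄` with its rank-one valuation):
`x ↦ C(p^N x)/C(p)^N` (`x ≠ 0`), `0 ↦ 0`.  The extension agrees with `C` on `O^▷_Ω`, preserves the valuation, and inherits the
`φ`-semilinearity of `C` for `Π_v` acting through `aug` (the `aug(φ g)` fix `C(p)`: `hfix`).
[cite: MochizukiFrdII2008, Thm 2.4 (ii) p.18] -/
theorem exists_extend_monoidWithZeroHom {P : Type u} [Group P] (aug : P →* d.Gal) (φ : P → P)
    (C : ↥(intNonzero d.Ω) →* ↥(intNonzero d.Ω))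
    (hv : ∀ x : intNonzero d.Ω, valuation d.Ω ((C x : intNonzero d.Ω) : d.Ω) = valuation d.Ω (x : d.Ω))
    (pΩ : intNonzero d.Ω) (hpΩ : (pΩ : d.Ω) = (p : ℕ))
    (hfix : ∀ g : P, (aug (φ g)) ((C pΩ : intNonzero d.Ω) : d.Ω) = C pΩ)
    (hs : ∀ (g : P) (x : intNonzero d.Ω), ((C (d.galAct (aug g) x) : intNonzero d.Ω) : d.Ω) = (aug (φ g)) (C x))
    (harch : ∀ x : d.Ω, ∃ N : ℕ, valuation d.Ω (((p : ℕ) : d.Ω) ^ N * x) ≤ 1) :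
    ∃ E : d.Ω →*₀ d.Ω, (∀ x : intNonzero d.Ω, E x = C x) ∧ (∀ x : d.Ω, valuation d.Ω (E x) = valuation d.Ω x) ∧
      ∀ (g : P) (x : d.Ω), E ((aug g) x) = (aug (φ g)) (E x) := by
  classical
  have hp0 : ((p : ℕ) : d.Ω) ≠ 0 := d.p_ne_zero_Ω
  have hCp0 : ((C pΩ : intNonzero d.Ω) : d.Ω) ≠ 0 := (C pΩ).2.2
  -- integral multiples `p^M x`, as elements of `O^▷_Ω`
  have hint : ∀ (x : d.Ω), x ≠ 0 → ∀ M : ℕ, valuation d.Ω (((p : ℕ) : d.Ω) ^ M * x) ≤ 1 →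
      ((p : ℕ) : d.Ω) ^ M * x ∈ intNonzero d.Ω := fun x hx M hM => ⟨hM, mul_ne_zero (pow_ne_zero _ hp0) hx⟩
  -- the candidate value at a given admissible exponent
  let val : ∀ (x : d.Ω) (hx : x ≠ 0) (M : ℕ), valuation d.Ω (((p : ℕ) : d.Ω) ^ M * x) ≤ 1 → d.Ω := fun x hx M hM =>
    ((C ⟨_, hint x hx M hM⟩ : intNonzero d.Ω) : d.Ω) * (((C pΩ : intNonzero d.Ω) : d.Ω) ^ M)⁻¹
  -- independence of the exponent
  have hwd : ∀ (x : d.Ω) (hx : x ≠ 0) (M M' : ℕ) (hM : valuation d.Ω (((p : ℕ) : d.Ω) ^ M * x) ≤ 1)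
      (hM' : valuation d.Ω (((p : ℕ) : d.Ω) ^ M' * x) ≤ 1), val x hx M hM = val x hx M' hM' := by
    intro x hx M M' hM hM'
    have hprod : (⟨_, hint x hx M hM⟩ : intNonzero d.Ω) * pΩ ^ M' = ⟨_, hint x hx M' hM'⟩ * pΩ ^ M := Subtype.ext (by
      change ((p : ℕ) : d.Ω) ^ M * x * (pΩ : d.Ω) ^ M' = ((p : ℕ) : d.Ω) ^ M' * x * (pΩ : d.Ω) ^ M
      rw [hpΩ]; ring)
    have h := congrArg (fun z : intNonzero d.Ω => ((C z : intNonzero d.Ω) : d.Ω)) hprod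
    simp only [map_mul, map_pow, Submonoid.coe_mul, SubmonoidClass.coe_pow] at h
    change _ * _ = _ * _
    rw [← div_eq_mul_inv, ← div_eq_mul_inv, div_eq_div_iff (pow_ne_zero _ hCp0) (pow_ne_zero _ hCp0)]
    exact h
  -- exponents
  choose Nx hNx using harch
  let E₀ : d.Ω → d.Ω := fun x => if hx : x = 0 then 0 else val x hx (Nx x) (hNx x)
  have hE₀ : ∀ (x : d.Ω) (hx : x ≠ 0) (M : ℕ) (hM : valuation d.Ω (((p : ℕ) : d.Ω) ^ M * x) ≤ 1),
      E₀ x = val x hx M hM := fun x hx M hM => by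
    show (if hx' : x = 0 then 0 else val x hx' (Nx x) (hNx x)) = val x hx M hM
    rw [dif_neg hx]
    exact hwd x hx (Nx x) M (hNx x) hM
  have hE₀int : ∀ x : intNonzero d.Ω, E₀ x = C x := fun x => by
    have h1 : valuation d.Ω (((p : ℕ) : d.Ω) ^ 0 * x) ≤ 1 := by rw [pow_zero, one_mul]; exact x.2.1
    have hx0 : (⟨_, hint x x.2.2 0 h1⟩ : intNonzero d.Ω) = x :=
      Subtype.ext (by change ((p : ℕ) : d.Ω) ^ 0 * x = x; rw [pow_zero, one_mul])
    rw [hE₀ x x.2.2 0 h1]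
    change ((C ⟨_, hint x x.2.2 0 h1⟩ : intNonzero d.Ω) : d.Ω) * (((C pΩ : intNonzero d.Ω) : d.Ω) ^ 0)⁻¹ = _
    rw [hx0, pow_zero, inv_one, mul_one]
  refine ⟨{ toFun := E₀, map_zero' := dif_pos rfl, map_one' := ?_, map_mul' := ?_ }, hE₀int, ?_, ?_⟩
  · have h := hE₀int 1
    rwa [OneMemClass.coe_one, map_one, OneMemClass.coe_one] at h
  · intro x y
    change E₀ (x * y) = E₀ x * E₀ y
    by_cases hx : x = 0
    · simp only [hx, zero_mul, E₀, dif_pos rfl]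
    by_cases hy : y = 0
    · simp only [hy, mul_zero, E₀, dif_pos rfl]
    have hxy : valuation d.Ω (((p : ℕ) : d.Ω) ^ (Nx x + Nx y) * (x * y)) ≤ 1 := by
      rw [show ((p : ℕ) : d.Ω) ^ (Nx x + Nx y) * (x * y) = (((p : ℕ) : d.Ω) ^ Nx x * x) * (((p : ℕ) : d.Ω) ^ Nx y * y) by ring,
        Valuation.map_mul]
      exact mul_le_one' (hNx x) (hNx y)
    rw [hE₀ (x * y) (mul_ne_zero hx hy) _ hxy, hE₀ x hx _ (hNx x), hE₀ y hy _ (hNx y)]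
    have hprod : (⟨_, hint (x * y) (mul_ne_zero hx hy) _ hxy⟩ : intNonzero d.Ω) =
        ⟨_, hint x hx _ (hNx x)⟩ * ⟨_, hint y hy _ (hNx y)⟩ := Subtype.ext (by
      change ((p : ℕ) : d.Ω) ^ (Nx x + Nx y) * (x * y) = (((p : ℕ) : d.Ω) ^ Nx x * x) * (((p : ℕ) : d.Ω) ^ Nx y * y)
      ring)
    change ((C _ : intNonzero d.Ω) : d.Ω) * _ = (((C _ : intNonzero d.Ω) : d.Ω) * _) * (((C _ : intNonzero d.Ω) : d.Ω) * _)
    rw [hprod, map_mul, Submonoid.coe_mul, pow_add, mul_inv]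
    ring
  · intro x
    by_cases hx : x = 0
    · change valuation d.Ω (E₀ x) = _
      simp only [hx, E₀, dif_pos rfl]
    change valuation d.Ω (E₀ x) = _
    rw [hE₀ x hx _ (hNx x)]
    change valuation d.Ω (((C _ : intNonzero d.Ω) : d.Ω) * _) = _
    have hpv : valuation d.Ω ((C pΩ : intNonzero d.Ω) : d.Ω) = valuation d.Ω ((p : ℕ) : d.Ω) := by rw [hv, hpΩ]
    rw [Valuation.map_mul, Valuation.map_inv, Valuation.map_pow, hv, hpv]
    change valuation d.Ω (((p : ℕ) : d.Ω) ^ Nx x * x) * _ = _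
    rw [Valuation.map_mul, Valuation.map_pow, mul_comm, ← mul_assoc,
      inv_mul_cancel₀ (pow_ne_zero _ ((Valuation.ne_zero_iff _).mpr hp0)), one_mul]
  · intro g x
    change E₀ ((aug g) x) = (aug (φ g)) (E₀ x)
    by_cases hx : x = 0
    · simp only [hx, map_zero, E₀, dif_pos rfl]
    have hgx : (aug g) x ≠ 0 := (map_ne_zero_iff _ (aug g).injective).mpr hx
    have hM : valuation d.Ω (((p : ℕ) : d.Ω) ^ Nx x * (aug g) x) ≤ 1 := by
      rw [show ((p : ℕ) : d.Ω) ^ Nx x * (aug g) x = (aug g) (((p : ℕ) : d.Ω) ^ Nx x * x) by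
        rw [map_mul, map_pow, map_natCast], d.valuation_gal_le_one_iff]
      exact hNx x
    rw [hE₀ _ hgx _ hM, hE₀ x hx _ (hNx x)]
    have hgal : (⟨_, hint _ hgx _ hM⟩ : intNonzero d.Ω) = d.galAct (aug g) ⟨_, hint x hx _ (hNx x)⟩ := Subtype.ext (by
      change ((p : ℕ) : d.Ω) ^ Nx x * (aug g) x = (aug g) (((p : ℕ) : d.Ω) ^ Nx x * x)
      rw [map_mul, map_pow, map_natCast])
    change ((C _ : intNonzero d.Ω) : d.Ω) * _ = (aug (φ g)) (((C _ : intNonzero d.Ω) : d.Ω) * _)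
    rw [hgal, hs, map_mul, map_inv₀, map_pow, hfix]

end Extension

/-! ### Untwisting by the anabelian input (E2), then Kummer rigidity (E3) -/

section Untwist

variable {p : ℕ} [Fact p.Prime] (d : GaloisValDatum.{u} p)

/-- **(E2) + (E3) ⇒ the unit transport is `σ` on `k`.**  If `E : Ω →*₀ Ω` preserves the valuation and is `φ`-semilinear
for `Π_v` acting through the SURJECTIVE `aug : Π_v → Gal(Ω/k)`, and `φ` is GEOMETRIC — covered by a valuation-preserving
ring automorphism `σ` of `Ω` with `σ(aug(g)·x) = aug(φ g)·σ(x)` (print's anabelian input "[AbsTopIII] Prop. 3.2 (iii)", a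
HYPOTHESIS here) — then `σ⁻¹ ∘ E` is `Gal(Ω/k)`-equivariant and valuation-preserving, so by the Kummer rigidity `hE3`
(abc-iut-w4-d014's `map_algebraMap_eq_self_of_*`, as a hypothesis in generic form) it fixes `k`: `E = σ` on `k`.
(The unit `U = C(p)/p` of clause (e), [IUTchI] Ex 3.3 (iii) (e) p.79.) [claim: Mochizuki2012, status: disputed] -/
theorem map_algebraMap_eq_of_geometric {P : Type u} [Group P] (aug : P →* d.Gal) (hs : Surjective aug) (φ : P → P)
    (E : d.Ω →*₀ d.Ω) (hEv : ∀ x, valuation d.Ω (E x) = valuation d.Ω x)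
    (hEs : ∀ (g : P) (x : d.Ω), E ((aug g) x) = (aug (φ g)) (E x))
    (σ : d.Ω ≃+* d.Ω) (hσv : ∀ x, valuation d.Ω (σ x) = valuation d.Ω x)
    (hσ : ∀ (g : P) (x : d.Ω), σ ((aug g) x) = (aug (φ g)) (σ x))
    (hE3 : ∀ C : d.Ω →*₀ d.Ω, (∀ (τ : d.Gal) (x : d.Ω), C (τ x) = τ (C x)) →
      (∀ x, valuation d.Ω (C x) = valuation d.Ω x) → ∀ a : d.k, C (algebraMap d.k d.Ω a) = algebraMap d.k d.Ω a)
    (a : d.k) : E (algebraMap d.k d.Ω a) = σ (algebraMap d.k d.Ω a) := by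
  let C : d.Ω →*₀ d.Ω := σ.symm.toRingHom.toMonoidWithZeroHom.comp E
  have hC : ∀ x, C x = σ.symm (E x) := fun _ => rfl
  have hσ' : ∀ (g : P) (y : d.Ω), σ.symm ((aug (φ g)) y) = (aug g) (σ.symm y) := fun g y => by
    apply σ.injective
    rw [σ.apply_symm_apply, hσ, σ.apply_symm_apply]
  have h1 : ∀ (τ : d.Gal) (x : d.Ω), C (τ x) = τ (C x) := fun τ x => by
    obtain ⟨g, rfl⟩ := hs τ
    rw [hC, hC, hEs, hσ']
  have h2 : ∀ x, valuation d.Ω (C x) = valuation d.Ω x := fun x => by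
    rw [hC, ← hσv (σ.symm (E x)), σ.apply_symm_apply, hEv]
  have h := hE3 C h1 h2 a
  rw [hC] at h
  rw [← σ.apply_symm_apply (E (algebraMap d.k d.Ω a)), h]

end Untwist

/-! ### Assembly: (E1) + (E2) + (E3) ⇒ `Ψ` preserves "rational function `= p^m`" on `O^▷`, i.e. preserves `τ_p` -/

section Assembly

variable {p : ℕ} [Fact p.Prime] (d : GaloisValDatum.{u} p) {P : Type u} [Group P] [TopologicalSpace P]
  (aug : P →* d.Gal) (Q : Datum (CosetCat P) p)
  (ε : ∀ A : CosetCat P, Q.fld A →+* d.Ω) (hεi : ∀ A, Injective (ε A))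
  (hε : ∀ ⦃A B : CosetCat P⦄ (f : A ⟶ B) (g : P), CosetCat.pt f = ((g : P) : B.carrier) →
    ∀ y : Q.fld B, ε A ((Q.base.map f).alg y) = (aug g) (ε B y))
  (Ψ : Q.frobenioid ≌ Q.frobenioid) (ΨBase : CosetCat P ⥤ CosetCat P)
  (η : Ψ.functor ⋙ (ModelFrobenioid.data Q.Φ Q.B Q.divB).base ≅ (ModelFrobenioid.data Q.Φ Q.B Q.divB).base ⋙ ΨBase)
  (hdeg : ∀ ⦃X Y : Q.frobenioid⦄ (φ : X ⟶ Y), ModelFrobenioid.degFr (Ψ.functor.map φ) = ModelFrobenioid.degFr φ)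
  (e : ∀ X : Q.frobenioid, ΨBase.obj X.base ⟶ (Ψ.functor.obj X).base)
  (he : ∀ ⦃Z Y : Q.frobenioid⦄ (lam : Z ⟶ Y),
    ΨBase.map (ModelFrobenioid.baseMap lam) ≫ e Y = e Z ≫ ModelFrobenioid.baseMap (Ψ.functor.map lam))
  (N N₂ : ℕ → OpenNormalSubgroup P) (hN : Antitone N) (hN₂ : Antitone N₂)
  (j : ∀ k, cQ (N₂ k) ⟶ ΨBase.obj (cQ (N k)))
  (hj : ∀ ⦃k k' : ℕ⦄ (h : k ≤ k'), j k' ≫ ΨBase.map (cproj (hN h)) = cproj (hN₂ h) ≫ j k)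
  (φ : P → P) (hφ : ∀ (k : ℕ) (g : P), crightMul (N₂ k) (φ g) ≫ j k = j k ≫ ΨBase.map (crightMul (N k) g))

include hN η hdeg he hεi hε hj hφ in
/-- **[IUTchI] Ex. 3.3 (iii) (e), the unit: a self-equivalence of the REAL `C_v` preserves "the rational function is
`p^m`" on `O^▷(−)` — GIVEN the anabelian input (E2) for the induced automorphism `φ` of `Π_v` and the Kummer rigidity
(E3).**  Hypotheses: the datum over `CosetCat Π_v` read in `Ω = K̄_v` (`ε`, `hε`, `hεle`, `hεs`), `Ψ` with its [FrdI]
Cor. 4.11 (iv) data, the straightening `(N, N₂, j, φ)`, (INT), the ramification clause, slimness/FSM, the archimedean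
property of `v` on `Ω`, `aug` continuous and surjective; `hσ` = (E2) for `φ`; `hE3` = (E3).  Conclusion: for every object
`X` and `w ∈ O^▷(X)`, `u_w|_{K^×} = p^m ↔ u_{Ψ w}|_{K^×} = p^m` — the hypothesis `H` of abc-iut-L5-t16's
`map_pSplittingSubmonoid_eq_of_units` (transport of `τ_p`). ([IUTchI] Ex 3.3 (iii) (e) p.79) [claim: Mochizuki2012, status: disputed] -/
theorem resK_unit_eq_pow_iff_of_geometric [ΨBase.Faithful] (hc : Continuous aug) (hs : Surjective aug)
    (hNb : ∀ U ∈ 𝓝 (1 : P), ∃ k, (N k : Set P) ⊆ U)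
    (hεle : ∀ (A : CosetCat P) (a b : Q.fld A), ε A a ≤ᵥ ε A b ↔ a ≤ᵥ b)
    (hεs : ∀ (A : CosetCat P) (x : d.Ω), (∀ u ∈ A.sg, (aug u) x = x) → ∃ y : Q.fld A, ε A y = x)
    (hint : ∀ (A : CosetCat P) (a : OrdInt (Q.fld A)), ∃ x : Q.Φ.obj (op A), Q.ιHom A x = Realification.of _ a)
    (hD : IsOfFSMType (CosetCat P)) (hsl : IsSlim (CosetCat P))
    (hram : ∀ X : Q.frobenioid, ∃ ι : OrdInt (Q.fld X.base) ≃* OrdInt (Q.fld (Ψ.functor.obj X).base),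
      ι (Associates.mk ⟨((p : ℕ) : Q.fld X.base), (Q.base.obj X.base).p_mem⟩) =
        Associates.mk ⟨((p : ℕ) : Q.fld (Ψ.functor.obj X).base), (Q.base.obj (Ψ.functor.obj X).base).p_mem⟩)
    (harch : ∀ x : d.Ω, ∃ M : ℕ, valuation d.Ω (((p : ℕ) : d.Ω) ^ M * x) ≤ 1)
    (hσ : ∃ σ : d.Ω ≃+* d.Ω, (∀ x, valuation d.Ω (σ x) = valuation d.Ω x) ∧
      ∀ (g : P) (x : d.Ω), σ ((aug g) x) = (aug (φ g)) (σ x))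
    (hE3 : ∀ C : d.Ω →*₀ d.Ω, (∀ (τ : d.Gal) (x : d.Ω), C (τ x) = τ (C x)) →
      (∀ x, valuation d.Ω (C x) = valuation d.Ω x) → ∀ a : d.k, C (algebraMap d.k d.Ω a) = algebraMap d.k d.Ω a)
    (X : Q.frobenioid) {w : X ⟶ X} (hw : w ∈ PreFrobenioid.endSubmonoid Q.structureFunctor X) (m : ℕ) :
    Q.resK _ (ModelFrobenioid.unit w) = Q.primeUnit X.base ^ m ↔
      Q.resK _ (ModelFrobenioid.unit (Ψ.functor.map w)) = Q.primeUnit (Ψ.functor.obj X).base ^ m := by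
  -- a level of the tower below `Base X`
  obtain ⟨k₀, hk₀⟩ : ∃ k₀, (N k₀).toOpenSubgroup ≤ X.base.sg := by
    obtain ⟨k₀, hk₀⟩ := hNb _ (X.base.sg.isOpen.mem_nhds X.base.sg.one_mem)
    exact ⟨k₀, fun u hu => hk₀ hu⟩
  obtain ⟨C, hCi, hCs, hCu, hCp, hCl⟩ := exists_unitTransport d aug Q ε hεi hε Ψ ΨBase η hdeg e he N N₂ hN hN₂ j hj φ hφ
    hc hNb hεle hεs hint hD hsl hram X k₀ hk₀
  -- `p` as a nonzero integer of `Ω`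
  let pΩ : intNonzero d.Ω := d.toΩ ⟨((p : ℕ) : d.k), d.p_mem⟩
  have hpΩ : (pΩ : d.Ω) = (p : ℕ) := map_natCast (algebraMap d.k d.Ω) p
  -- `C` preserves the valuation
  have halg : ∀ x : intNonzero d.Ω, ∃ b a : ℕ, 0 < b ∧
      valuation d.Ω (x : d.Ω) ^ b = valuation d.Ω ((p : ℕ) : d.Ω) ^ a := fun x => by
    obtain ⟨k, -, hk⟩ := exists_level d aug N hN hc hNb 0 x
    obtain ⟨y, hy⟩ := exists_intNonzero_fld d aug Q ε hεle hεs (cQ (N k)) x hk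
    obtain ⟨b, a, hb, h⟩ := exists_valuation_pow_eq d Q ε hεle (cQ (N k)) y
    exact ⟨b, a, hb, by rw [← hy]; exact h⟩
  have hv : ∀ x : intNonzero d.Ω, valuation d.Ω ((C x : intNonzero d.Ω) : d.Ω) = valuation d.Ω (x : d.Ω) :=
    valuation_map_eq_of_units d C hCu pΩ hpΩ (hCp pΩ hpΩ) halg
  -- `C(p)` is `Gal`-fixed
  have hfix : ∀ g : P, (aug (φ g)) ((C pΩ : intNonzero d.Ω) : d.Ω) = C pΩ := fun g => by
    rw [← hCs g pΩ, GaloisValDatum.galAct_toΩ]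
  -- extension to `Ω`, untwisting, Kummer rigidity: `C(p) = p`
  obtain ⟨E, hEC, hEv, hEs⟩ := exists_extend_monoidWithZeroHom d aug φ C hv pΩ hpΩ hfix hCs harch
  obtain ⟨σ, hσv, hσ'⟩ := hσ
  have hCp' : ((C pΩ : intNonzero d.Ω) : d.Ω) = (p : ℕ) := by
    rw [← hEC, hpΩ, ← map_natCast (algebraMap d.k d.Ω) p,
      map_algebraMap_eq_of_geometric d aug hs φ E hEv hEs σ hσv hσ' hE3, map_natCast, map_natCast]
  -- the rational function of `w`, read in `Ω`
  have hΨw := (Q.map_mem_endSubmonoid_iff Ψ ΨBase η hdeg w).mpr hw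
  have hxmem : ε X.base ((Q.resK _ (ModelFrobenioid.unit w) : (Q.fld X.base)ˣ) : Q.fld X.base) ∈ intNonzero d.Ω := by
    refine ⟨?_, (map_ne_zero_iff _ (hεi _)).mpr (Units.ne_zero _)⟩
    rw [← (valuation d.Ω).map_one, ← Valuation.Compatible.vle_iff_le, ← (ε X.base).map_one, hεle,
      Valuation.Compatible.vle_iff_le (v := valuation (Q.fld X.base)), map_one]
    exact Q.valuation_resK_le_one_of_divB_eq_of _ _ _ (Q.of_div_eq_divB_unit hw).symm
  have hlink := hCl w hw ⟨_, hxmem⟩ rfl m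
  rw [hlink]
  -- `u_w = p^m ↔ ε(u_w) = p^m ↔ C(ε u_w) = p^m`
  rw [Units.ext_iff, Units.val_pow_eq_pow_val, Datum.coe_primeUnit]
  constructor
  · intro h
    have hx : (⟨_, hxmem⟩ : intNonzero d.Ω) = pΩ ^ m := Subtype.ext (by
      change ε X.base _ = _
      rw [h, map_pow, map_natCast, SubmonoidClass.coe_pow, hpΩ])
    rw [hx, map_pow, SubmonoidClass.coe_pow, hCp']
  · intro h
    have hx : C ⟨_, hxmem⟩ = C (pΩ ^ m) := Subtype.ext (by rw [h, map_pow, SubmonoidClass.coe_pow, hCp'])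
    have hx' := congrArg (fun z : intNonzero d.Ω => (z : d.Ω)) (hCi hx)
    change ε X.base _ = ((pΩ ^ m : intNonzero d.Ω) : d.Ω) at hx'
    rw [SubmonoidClass.coe_pow, hpΩ] at hx'
    exact (ε X.base).injective (by rw [hx', map_pow, map_natCast])

include hN η hdeg he hεi hε hj hφ in
/-- **[IUTchI] Ex. 3.3 (iii) (e) over the REAL bases, the characteristic splitting: GIVEN (E2) and (E3), every
self-equivalence `Ψ` of `C_v` carries `τ_p(A)` onto `τ_p(Ψ A)` for every object `A`** (abc-iut-L5-t16's
`map_pSplittingSubmonoid_eq_of_units` applied to `resK_unit_eq_pow_iff_of_geometric`) — the hypothesis `hfix` of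
abc-iut-w4-d047's criterion `splitFromF_of_cdashFromF_of_isPreservedBy` for `σ = ⟨τ_p⟩`.
([IUTchI] Ex 3.3 (iii) (e) p.79) [claim: Mochizuki2012, status: disputed] -/
theorem map_pSplittingSubmonoid_eq_of_geometric [ΨBase.Faithful] (hc : Continuous aug) (hs : Surjective aug)
    (hNb : ∀ U ∈ 𝓝 (1 : P), ∃ k, (N k : Set P) ⊆ U)
    (hεle : ∀ (A : CosetCat P) (a b : Q.fld A), ε A a ≤ᵥ ε A b ↔ a ≤ᵥ b)
    (hεs : ∀ (A : CosetCat P) (x : d.Ω), (∀ u ∈ A.sg, (aug u) x = x) → ∃ y : Q.fld A, ε A y = x)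
    (hint : ∀ (A : CosetCat P) (a : OrdInt (Q.fld A)), ∃ x : Q.Φ.obj (op A), Q.ιHom A x = Realification.of _ a)
    (hD : IsOfFSMType (CosetCat P)) (hsl : IsSlim (CosetCat P))
    (hram : ∀ X : Q.frobenioid, ∃ ι : OrdInt (Q.fld X.base) ≃* OrdInt (Q.fld (Ψ.functor.obj X).base),
      ι (Associates.mk ⟨((p : ℕ) : Q.fld X.base), (Q.base.obj X.base).p_mem⟩) =
        Associates.mk ⟨((p : ℕ) : Q.fld (Ψ.functor.obj X).base), (Q.base.obj (Ψ.functor.obj X).base).p_mem⟩)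
    (harch : ∀ x : d.Ω, ∃ M : ℕ, valuation d.Ω (((p : ℕ) : d.Ω) ^ M * x) ≤ 1)
    (hσ : ∃ σ : d.Ω ≃+* d.Ω, (∀ x, valuation d.Ω (σ x) = valuation d.Ω x) ∧
      ∀ (g : P) (x : d.Ω), σ ((aug g) x) = (aug (φ g)) (σ x))
    (hE3 : ∀ C : d.Ω →*₀ d.Ω, (∀ (τ : d.Gal) (x : d.Ω), C (τ x) = τ (C x)) →
      (∀ x, valuation d.Ω (C x) = valuation d.Ω x) → ∀ a : d.k, C (algebraMap d.k d.Ω a) = algebraMap d.k d.Ω a)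
    (X : Q.frobenioid) :
    (Q.pSplittingSubmonoid X).map (Ψ.functor.mapEnd X) = Q.pSplittingSubmonoid (Ψ.functor.obj X) :=
  Q.map_pSplittingSubmonoid_eq_of_units Ψ ΨBase η hdeg (fun Y _ hw m =>
    resK_unit_eq_pow_iff_of_geometric d aug Q ε hεi hε Ψ ΨBase η hdeg e he N N₂ hN hN₂ j hj φ hφ hc hs hNb hεle hεs hint hD
      hsl hram harch hσ hE3 Y hw m) X

end Assembly

end UnitTransport

end GoodLocalFrobenioid

end Literature.IUT.HodgeTheaters

end
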